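import Mathlib.Analysis.Calculus.Deriv.MeanValue

/-!
# `ErgoregionBombModT` — R1: on `ℝ`, `φ' = u`, `u' = w > 0` forces `φ` unbounded
# (crux stmt-FinalStateConjecture-17838, line `SketchIdeator4` / zero-energy escape, stub R1)

Route `ZeroEnergyKerrOrBomb` of the Final State Conjecture, crux `ErgoregionBombModT`, species (a)
(the COMPLETE case, domain `ℝ`) of the real-variable half of the zero-energy escape engine: if
`φ' = u` and `u' = w > 0` everywhere on `ℝ`, then `φ` is unbounded (in absolute value).  Along a
complete zero-energy null geodesic `γ` this is applied to `φ := F ∘ γ`, `u := dF(γ̇)`,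
`w := Hess F(γ̇, γ̇)`.

* `exists_lt_of_hasDerivAt_of_monotone` — if `φ' = u` with `u` monotone and `0 < u a`, then
  `φ` is unbounded above: the mean value inequality on `[a, ∞)` gives
  `φ t ≥ φ a + u a · (t - a)`.
* `stub_convexBoundedLine` — the registered stub: `u` is strictly increasing, so either
  `0 ≤ u 0 < u 1` (apply the lemma at `a = 1`) or `u 0 < 0` (apply it to the reflection
  `t ↦ φ (-t)`, whose derivative `t ↦ -u (-t)` is monotone and positive at `0`).

References: mean value inequality `Convex.mul_sub_le_image_sub_of_le_deriv` and
`strictMono_of_hasDerivAt_pos` (Mathlib); crux workfile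
`Cruxes/ErgoregionBombModT/Ideas/zero-energy-escape.md`.
-/

noncomputable section

open Set

-- summit = problem name (D-0017)
set_option linter.dupNamespace false

namespace Summit.FinalStateConjecture.FinalStateConjecture.Theorems.ErgoregionBombModT

/-- **One-sided linear growth.**  If `φ` has derivative `u` everywhere, `u` is monotone and
`0 < u a`, then `φ` is unbounded above: for `t ≥ a` the mean value inequality on the convex set
`[a, ∞)` (where `φ' = u ≥ u a`) gives `u a · (t - a) ≤ φ t - φ a`, and
`t := a + (|M| + |φ a| + 1) / u a` does the job. -/
theorem exists_lt_of_hasDerivAt_of_monotone {φ u : ℝ → ℝ} (hφ : ∀ t, HasDerivAt φ (u t) t)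
    (hu : Monotone u) {a : ℝ} (ha : 0 < u a) (M : ℝ) : ∃ t, M < φ t := by
  have hd : Differentiable ℝ φ := fun t => (hφ t).differentiableAt
  have key : ∀ t, a ≤ t → u a * (t - a) ≤ φ t - φ a := by
    intro t hat
    refine (convex_Ici a).mul_sub_le_image_sub_of_le_deriv hd.continuous.continuousOn
      hd.differentiableOn (fun x hx => ?_) a self_mem_Ici t hat hat
    rw [interior_Ici] at hx
    rw [(hφ x).deriv]
    exact hu (le_of_lt hx)
  have hne : u a ≠ 0 := ha.ne'
  have hq : 0 ≤ (|M| + |φ a| + 1) / u a := by positivity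
  have h1 := key (a + (|M| + |φ a| + 1) / u a) (by linarith)
  have h2 : u a * (a + (|M| + |φ a| + 1) / u a - a) = |M| + |φ a| + 1 := by
    field_simp
    ring
  have h3 : M ≤ |M| := le_abs_self M
  have h4 : -φ a ≤ |φ a| := neg_le_abs (φ a)
  exact ⟨a + (|M| + |φ a| + 1) / u a, by linarith⟩

/-- **R1 (real line, species (a)).**  A function `φ` on `ℝ` with a derivative `u` which itself
has a strictly positive derivative `w` everywhere is unbounded: `u` is strictly increasing
(`strictMono_of_hasDerivAt_pos`); if `0 ≤ u 0` then `0 < u 1` and `φ → +∞` to the right of `1`;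
if `u 0 < 0` then the reflection `t ↦ φ (-t)` has the monotone derivative `t ↦ -u (-t)`, positive
at `0`, so `φ → +∞` to the left of `0`.  In both cases `M < φ t ≤ |φ t|` for some `t`. -/
theorem stub_convexBoundedLine :
    ∀ (φ u w : ℝ → ℝ), (∀ t, HasDerivAt φ (u t) t) → (∀ t, HasDerivAt u (w t) t) → (∀ t, 0 < w t) →
      ∀ M : ℝ, ∃ t, M < |φ t| := by
  intro φ u w hφ hu hw M
  have hmono : StrictMono u := strictMono_of_hasDerivAt_pos hu hw
  rcases le_or_gt 0 (u 0) with h0 | h0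
  · have h1 : 0 < u 1 := h0.trans_lt (hmono zero_lt_one)
    obtain ⟨t, ht⟩ := exists_lt_of_hasDerivAt_of_monotone hφ hmono.monotone h1 M
    exact ⟨t, ht.trans_le (le_abs_self _)⟩
  · have hψ : ∀ t, HasDerivAt (fun s => φ (-s)) (-u (-t)) t := by
      intro t
      have h := (hφ (-t)).comp t (hasDerivAt_neg t)
      simpa [Function.comp_def] using h
    have hmono' : Monotone (fun t => -u (-t)) := fun s t hst =>
      neg_le_neg (hmono.monotone (neg_le_neg hst))
    have h1 : 0 < (fun t => -u (-t)) 0 := by simpa using h0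
    obtain ⟨t, ht⟩ := exists_lt_of_hasDerivAt_of_monotone hψ hmono' h1 M
    exact ⟨-t, ht.trans_le (le_abs_self _)⟩

end Summit.FinalStateConjecture.FinalStateConjecture.Theorems.ErgoregionBombModT
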